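import Mathlib
import Summits.NavierStokesRegularity.NavierStokesRegularity.Theorems.EulerZoomLiouvillePowerGaugeEulerLiouvilleSeparableEulerBrackets
import HarnessLib

/-!
# Crux `EulerZoomLiouville.PowerGaugeEulerLiouville` (stmt-NavierStokesRegularity-19832), stub `stub_nonSelfSimilarRest`:
# EULER BRACKETS OF A STEADY FIELD PLUS ONE MODULATED PATTERN `v(τ, x) = U₀(x) + θ(τ) U₁(x)` — tools; the RICCATI exception

Helper file (theorems only; `--supports stmt-NavierStokesRegularity-19832`; def-free).  Hand leafhand-ns-eulerzoomliouville-11 g0;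
sequel to `…SeparableEulerBrackets` (`U₀ = 0`).  After this hand's gauge files the residual of the lane `u = U₀(x) + θ(τ)U₁(x)` is the
EVANESCENT modulation (`θ → const` in Cesàro mean square); it needs the Euler identity.  For a distributional Euler pair `(v, p)` on
`(−∞,0) × ℝ³` whose slices are LITERALLY `v(τ) = U₀ + θ(τ) U₁` for `τ < T₁ ≤ 0` (`θ` continuous, `U₀, U₁ ∈ L¹_loc ∩ L²_loc`):
* `ModulatedEuler.raw_momentum` — the momentum identity tensor-tested with `χ(τ)Φ(x)` (`div Φ = 0`, `χ ∈ C_c^∞((−∞,T₁))`):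
  `∫ (χ' (A₀ + θA₁) + χ (N₀₀ + θ N× + θ² N₁₁)) = 0` with `Aᵢ = ∫⟪Uᵢ,Φ⟫`, `N(V) = ∫⟪V, DΦ·V⟫`, `N₀₀ = N(U₀)`, `N₁₁ = N(U₁)`,
  `N× = N(U₀+U₁) − N₀₀ − N₁₁` (polarised mixed term);
* `ModulatedEuler.pointwise_momentum` (`θ ∈ C¹`) — `N₀₀ + θ(t) N× + θ(t)² N₁₁ = θ'(t) A₁` for every `t < T₁`;
* `ModulatedEuler.pointwise_div` — `∫⟪U₀,∇g⟫ + θ(t) ∫⟪U₁,∇g⟫ = 0` for every `t < T₁`;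
* `ModulatedEuler.integral_inner_eq_zero_of_not_riccati`, `…isWeaklyDivFree_of_not_riccati` — UNLESS `θ` SOLVES A CONSTANT-COEFFICIENT
  RICCATI EQUATION `θ' = α + βθ + γθ²` on `(−∞,T₁)`, the pattern `U₁` is weakly orthogonal to every divergence-free test field and weakly
  divergence free.  (Riccati solutions: constants, affine `t`, `e^{βt}`, `tanh`, `1/(T−t)`, `tan` …; the growing ones are killed by the
  gauge files of this hand, the evanescent ones — `e^{βt} → 0`, `tanh → ±1`, `1/(T−t)` — are the residual of the lane.)

WHAT THIS IS NOT: not a proof of the stub or of the crux; nothing about Navier–Stokes. [folklore; CaffarelliKohnNirenberg1982 §2 (2.1)–(2.2)]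
-/

noncomputable section

-- flat `Theorems/<Route><Decl>…` files of one crux share the namespace of the crux (tree convention)
set_option linter.dupNamespace false

open MeasureTheory Set Filter Topology Metric Function TopologicalSpace
open scoped RealInnerProductSpace NNReal ENNReal ContDiff

namespace Summit.NavierStokesRegularity.NavierStokesRegularity.Theorems.PowerGaugeEulerLiouville

open Literature.Analysis Literature.Analysis.FunctionSpaces Literature.Analysis.FluidPDE

namespace ModulatedEuler

variable {v : ℝ → EuclideanSpace ℝ (Fin 3) → EuclideanSpace ℝ (Fin 3)} {p : ℝ → EuclideanSpace ℝ (Fin 3) → ℝ}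
  {θ : ℝ → ℝ} {U₀ U₁ : EuclideanSpace ℝ (Fin 3) → EuclideanSpace ℝ (Fin 3)} {T₁ : ℝ}

/-! ## 1. Slice pairings -/

/-- `|U₀ + U₁|² ∈ L¹_loc` from `|U₀|², |U₁|² ∈ L¹_loc`. [folklore] -/
theorem locallyIntegrable_sq_add (hU₀ : LocallyIntegrable U₀ volume) (hU₁ : LocallyIntegrable U₁ volume)
    (hU₀2 : LocallyIntegrable (fun y => ‖U₀ y‖ ^ 2) volume) (hU₁2 : LocallyIntegrable (fun y => ‖U₁ y‖ ^ 2) volume) :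
    LocallyIntegrable (fun y => ‖U₀ y + U₁ y‖ ^ 2) volume := by
  have hdom : LocallyIntegrable (fun y => 2 * ‖U₀ y‖ ^ 2 + 2 * ‖U₁ y‖ ^ 2) volume :=
    (hU₀2.smul (2 : ℝ)).add (hU₁2.smul (2 : ℝ))
  refine hdom.mono ((hU₀.aestronglyMeasurable.add hU₁.aestronglyMeasurable).norm.pow 2) (Eventually.of_forall fun y => ?_)
  rw [Real.norm_of_nonneg (sq_nonneg _), Real.norm_of_nonneg (by positivity)]
  have h := norm_add_le (U₀ y) (U₁ y)
  nlinarith [norm_nonneg (U₀ y + U₁ y), norm_nonneg (U₀ y), norm_nonneg (U₁ y), sq_nonneg (‖U₀ y‖ - ‖U₁ y‖)]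

/-- The quadratic slice pairing expanded: `∫⟪U₀ + s U₁, DΦ (U₀ + s U₁)⟫ = N₀₀ + s N× + s² N₁₁` with the POLARISED mixed term
`N× = N(U₀ + U₁) − N₀₀ − N₁₁`. [folklore] -/
theorem integral_quad_slice (hU₀ : LocallyIntegrable U₀ volume) (hU₁ : LocallyIntegrable U₁ volume)
    (hU₀2 : LocallyIntegrable (fun y => ‖U₀ y‖ ^ 2) volume) (hU₁2 : LocallyIntegrable (fun y => ‖U₁ y‖ ^ 2) volume)
    {Φ : EuclideanSpace ℝ (Fin 3) → EuclideanSpace ℝ (Fin 3)} (hΦ : IsTestFunctionOn (⊤ : Opens (EuclideanSpace ℝ (Fin 3))) Φ) (s : ℝ) :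
    ∫ y, ⟪U₀ y + s • U₁ y, (fderiv ℝ Φ y) (U₀ y + s • U₁ y)⟫ =
      (∫ y, ⟪U₀ y, (fderiv ℝ Φ y) (U₀ y)⟫) +
        s * ((∫ y, ⟪U₀ y + U₁ y, (fderiv ℝ Φ y) (U₀ y + U₁ y)⟫) - (∫ y, ⟪U₀ y, (fderiv ℝ Φ y) (U₀ y)⟫) -
          ∫ y, ⟪U₁ y, (fderiv ℝ Φ y) (U₁ y)⟫) +
        s ^ 2 * ∫ y, ⟪U₁ y, (fderiv ℝ Φ y) (U₁ y)⟫ := by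
  have hDΦc : Continuous (fderiv ℝ Φ) := hΦ.contDiff.continuous_fderiv (by simp)
  have hDΦs : HasCompactSupport (fderiv ℝ Φ) := hΦ.hasCompactSupport.fderiv (𝕜 := ℝ)
  have hq : ∀ {V : EuclideanSpace ℝ (Fin 3) → EuclideanSpace ℝ (Fin 3)}, LocallyIntegrable V volume →
      LocallyIntegrable (fun y => ‖V y‖ ^ 2) volume → Integrable (fun y => ⟪V y, (fderiv ℝ Φ y) (V y)⟫) volume := by
    intro V hV hV2
    have h0 := GalileanFrames.integrable_inner_clm_comp_add_self hV.aestronglyMeasurable hV2 hDΦc hDΦs 0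
    exact h0.congr (Eventually.of_forall fun y => by simp only [add_zero])
  have i0 := hq hU₀ hU₀2
  have i1 := hq hU₁ hU₁2
  have iS : Integrable (fun y => ⟪U₀ y + U₁ y, (fderiv ℝ Φ y) (U₀ y + U₁ y)⟫) volume :=
    hq (V := fun y => U₀ y + U₁ y) (hU₀.add hU₁) (locallyIntegrable_sq_add hU₀ hU₁ hU₀2 hU₁2)
  -- the mixed term, polarised
  set M : EuclideanSpace ℝ (Fin 3) → ℝ := fun y => ⟪U₀ y, (fderiv ℝ Φ y) (U₁ y)⟫ + ⟪U₁ y, (fderiv ℝ Φ y) (U₀ y)⟫ with hMdef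
  have hM : M = fun y => ⟪U₀ y + U₁ y, (fderiv ℝ Φ y) (U₀ y + U₁ y)⟫ - ⟪U₀ y, (fderiv ℝ Φ y) (U₀ y)⟫ -
      ⟪U₁ y, (fderiv ℝ Φ y) (U₁ y)⟫ := by
    funext y
    simp only [hMdef, map_add, inner_add_left, inner_add_right]
    ring
  have imix : Integrable M volume := by rw [hM]; exact (iS.sub i0).sub i1
  have hMint : ∫ y, M y = (∫ y, ⟪U₀ y + U₁ y, (fderiv ℝ Φ y) (U₀ y + U₁ y)⟫) - (∫ y, ⟪U₀ y, (fderiv ℝ Φ y) (U₀ y)⟫) -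
      ∫ y, ⟪U₁ y, (fderiv ℝ Φ y) (U₁ y)⟫ := by
    have iSA : Integrable (fun y => ⟪U₀ y + U₁ y, (fderiv ℝ Φ y) (U₀ y + U₁ y)⟫ - ⟪U₀ y, (fderiv ℝ Φ y) (U₀ y)⟫) volume :=
      iS.sub i0
    simp only [hM]
    rw [integral_sub iSA i1, integral_sub iS i0]
  have hpt : ∀ y, ⟪U₀ y + s • U₁ y, (fderiv ℝ Φ y) (U₀ y + s • U₁ y)⟫ =
      ⟪U₀ y, (fderiv ℝ Φ y) (U₀ y)⟫ + s * M y + s ^ 2 * ⟪U₁ y, (fderiv ℝ Φ y) (U₁ y)⟫ := by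
    intro y
    simp only [hMdef, map_add, map_smul, inner_add_left, inner_add_right, real_inner_smul_left, real_inner_smul_right]
    ring
  simp_rw [hpt]
  have iAM : Integrable (fun y => ⟪U₀ y, (fderiv ℝ Φ y) (U₀ y)⟫ + s * M y) volume := i0.add (imix.const_mul s)
  have iQ : Integrable (fun y => s ^ 2 * ⟪U₁ y, (fderiv ℝ Φ y) (U₁ y)⟫) volume := i1.const_mul _
  have iM' : Integrable (fun y => s * M y) volume := imix.const_mul s
  rw [integral_add iAM iQ, integral_add i0 iM', integral_const_mul, integral_const_mul, hMint]

/-! ## 2. The brackets -/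

/-- **RAW MOMENTUM BRACKET** of `v = U₀ + θ U₁`: `∫ (χ'(τ) (A₀ + θ(τ) A₁) + χ(τ) (N₀₀ + θ(τ) N× + θ(τ)² N₁₁)) dτ = 0`.
[cite: CaffarelliKohnNirenberg1982, §2 (2.1)–(2.2)] -/
theorem raw_momentum
    (hsol : IsDistributionalNSSolutionOn (slab (EuclideanSpace ℝ (Fin 3)) (Iio 0) isOpen_Iio) 0 0 v p)
    (hT₁ : T₁ ≤ 0) (hv : ∀ τ, τ < T₁ → v τ = fun x => U₀ x + θ τ • U₁ x)
    (hU₀ : LocallyIntegrable U₀ volume) (hU₁ : LocallyIntegrable U₁ volume)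
    (hU₀2 : LocallyIntegrable (fun y => ‖U₀ y‖ ^ 2) volume) (hU₁2 : LocallyIntegrable (fun y => ‖U₁ y‖ ^ 2) volume)
    {Φ : EuclideanSpace ℝ (Fin 3) → EuclideanSpace ℝ (Fin 3)} (hΦ : IsTestFunctionOn (⊤ : Opens (EuclideanSpace ℝ (Fin 3))) Φ)
    (hdiv : ∀ z, VectorCalculus.divergence Φ z = 0)
    {χ : ℝ → ℝ} (hχ : ContDiff ℝ (⊤ : ℕ∞) χ) (hχc : HasCompactSupport χ) (hχT : tsupport χ ⊆ Iio T₁) :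
    ∫ τ, (deriv χ τ * ((∫ y, ⟪U₀ y, Φ y⟫) + θ τ * ∫ y, ⟪U₁ y, Φ y⟫) +
      χ τ * ((∫ y, ⟪U₀ y, (fderiv ℝ Φ y) (U₀ y)⟫) +
        θ τ * ((∫ y, ⟪U₀ y + U₁ y, (fderiv ℝ Φ y) (U₀ y + U₁ y)⟫) - (∫ y, ⟪U₀ y, (fderiv ℝ Φ y) (U₀ y)⟫) -
          ∫ y, ⟪U₁ y, (fderiv ℝ Φ y) (U₁ y)⟫) +
        θ τ ^ 2 * ∫ y, ⟪U₁ y, (fderiv ℝ Φ y) (U₁ y)⟫)) = 0 := by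
  have hχ0 : tsupport χ ⊆ Iio 0 := hχT.trans (Iio_subset_Iio hT₁)
  have hΦc : Continuous Φ := hΦ.contDiff.continuous
  have hDΦc : Continuous (fderiv ℝ Φ) := hΦ.contDiff.continuous_fderiv (by simp)
  have hDΦs : HasCompactSupport (fderiv ℝ Φ) := hΦ.hasCompactSupport.fderiv (𝕜 := ℝ)
  have hSl : ∀ τ, LocallyIntegrable (fun x => U₀ x + θ τ • U₁ x) volume := fun τ => hU₀.add (hU₁.smul (θ τ))
  have hSl2 : ∀ τ, LocallyIntegrable (fun x => ‖U₀ x + θ τ • U₁ x‖ ^ 2) volume := by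
    intro τ
    have h1 : LocallyIntegrable (fun x => θ τ • U₁ x) volume := hU₁.smul (θ τ)
    have h2 : LocallyIntegrable (fun x => ‖θ τ • U₁ x‖ ^ 2) volume := by
      have e : (fun x => ‖θ τ • U₁ x‖ ^ 2) = fun x => θ τ ^ 2 * ‖U₁ x‖ ^ 2 := by
        funext x; rw [norm_smul, mul_pow, Real.norm_eq_abs, sq_abs]
      have h2' := hU₁2.smul (θ τ ^ 2)
      rw [e]
      exact h2'
    exact locallyIntegrable_sq_add hU₀ h1 hU₀2 h2
  have hint₁ : ∀ τ ∈ tsupport χ, Integrable (fun y => ⟪v τ y, Φ y⟫) volume := by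
    intro τ hτ
    rw [hv τ (hχT hτ)]
    exact integrable_inner_of_locallyIntegrable_of_hasCompactSupport (hSl τ) hΦc hΦ.hasCompactSupport
  have hint₂ : ∀ τ ∈ tsupport χ, Integrable (fun y => ⟪v τ y, (fderiv ℝ Φ y) (v τ y)⟫) volume := by
    intro τ hτ
    rw [hv τ (hχT hτ)]
    have h0 := GalileanFrames.integrable_inner_clm_comp_add_self (hSl τ).aestronglyMeasurable (hSl2 τ) hDΦc hDΦs 0
    exact h0.congr (Eventually.of_forall fun y => by simp only [add_zero])
  have h0 := GalileanFrames.integral_tensorTest hsol hΦ hdiv hχ hχc hχ0 hint₁ hint₂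
  have hχ0' : ∀ t, t ∉ tsupport χ → χ t = 0 := fun t ht => image_eq_zero_of_notMem_tsupport ht
  have hχ'0' : ∀ t, t ∉ tsupport χ → deriv χ t = 0 := fun t ht => by
    by_contra hne; exact ht (tsupport_deriv_subset (subset_tsupport _ (mem_support.2 hne)))
  have iA0 := integrable_inner_of_locallyIntegrable_of_hasCompactSupport hU₀ hΦc hΦ.hasCompactSupport
  have iA1 := integrable_inner_of_locallyIntegrable_of_hasCompactSupport hU₁ hΦc hΦ.hasCompactSupport
  have hpt : ∀ τ, deriv χ τ * (∫ y, ⟪v τ y, Φ y⟫) + χ τ * ∫ y, ⟪v τ y, (fderiv ℝ Φ y) (v τ y)⟫ =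
      deriv χ τ * ((∫ y, ⟪U₀ y, Φ y⟫) + θ τ * ∫ y, ⟪U₁ y, Φ y⟫) +
      χ τ * ((∫ y, ⟪U₀ y, (fderiv ℝ Φ y) (U₀ y)⟫) +
        θ τ * ((∫ y, ⟪U₀ y + U₁ y, (fderiv ℝ Φ y) (U₀ y + U₁ y)⟫) - (∫ y, ⟪U₀ y, (fderiv ℝ Φ y) (U₀ y)⟫) -
          ∫ y, ⟪U₁ y, (fderiv ℝ Φ y) (U₁ y)⟫) +
        θ τ ^ 2 * ∫ y, ⟪U₁ y, (fderiv ℝ Φ y) (U₁ y)⟫) := by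
    intro τ
    by_cases hτ : τ ∈ tsupport χ
    · rw [hv τ (hχT hτ)]
      have e1 : ∫ y, ⟪U₀ y + θ τ • U₁ y, Φ y⟫ = (∫ y, ⟪U₀ y, Φ y⟫) + θ τ * ∫ y, ⟪U₁ y, Φ y⟫ := by
        rw [← integral_const_mul, ← integral_add iA0 (iA1.const_mul _)]
        exact integral_congr_ae (Eventually.of_forall fun y => by simp only [inner_add_left, real_inner_smul_left])
      simp only [e1, integral_quad_slice hU₀ hU₁ hU₀2 hU₁2 hΦ (θ τ)]
    · rw [hχ0' τ hτ, hχ'0' τ hτ]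
      ring
  simp_rw [hpt] at h0
  exact h0

/-- **POINTWISE MOMENTUM BRACKET** (`θ ∈ C¹`): `N₀₀ + θ(t) N× + θ(t)² N₁₁ = θ'(t) A₁` for every `t < T₁`. [folklore] -/
theorem pointwise_momentum
    (hsol : IsDistributionalNSSolutionOn (slab (EuclideanSpace ℝ (Fin 3)) (Iio 0) isOpen_Iio) 0 0 v p)
    (hT₁ : T₁ ≤ 0) (hv : ∀ τ, τ < T₁ → v τ = fun x => U₀ x + θ τ • U₁ x) (hθ1 : ContDiff ℝ 1 θ)
    (hU₀ : LocallyIntegrable U₀ volume) (hU₁ : LocallyIntegrable U₁ volume)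
    (hU₀2 : LocallyIntegrable (fun y => ‖U₀ y‖ ^ 2) volume) (hU₁2 : LocallyIntegrable (fun y => ‖U₁ y‖ ^ 2) volume)
    {Φ : EuclideanSpace ℝ (Fin 3) → EuclideanSpace ℝ (Fin 3)} (hΦ : IsTestFunctionOn (⊤ : Opens (EuclideanSpace ℝ (Fin 3))) Φ)
    (hdiv : ∀ z, VectorCalculus.divergence Φ z = 0) {t : ℝ} (ht : t < T₁) :
    (∫ y, ⟪U₀ y, (fderiv ℝ Φ y) (U₀ y)⟫) +
        θ t * ((∫ y, ⟪U₀ y + U₁ y, (fderiv ℝ Φ y) (U₀ y + U₁ y)⟫) - (∫ y, ⟪U₀ y, (fderiv ℝ Φ y) (U₀ y)⟫) -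
          ∫ y, ⟪U₁ y, (fderiv ℝ Φ y) (U₁ y)⟫) +
        θ t ^ 2 * ∫ y, ⟪U₁ y, (fderiv ℝ Φ y) (U₁ y)⟫ = deriv θ t * ∫ y, ⟪U₁ y, Φ y⟫ := by
  have hθc : Continuous θ := hθ1.continuous
  have hθ'c : Continuous (deriv θ) := hθ1.continuous_deriv le_rfl
  set A₀ : ℝ := ∫ y, ⟪U₀ y, Φ y⟫
  set A₁ : ℝ := ∫ y, ⟪U₁ y, Φ y⟫
  set N₀ : ℝ := ∫ y, ⟪U₀ y, (fderiv ℝ Φ y) (U₀ y)⟫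
  set N₁ : ℝ := ∫ y, ⟪U₁ y, (fderiv ℝ Φ y) (U₁ y)⟫
  set NS : ℝ := ∫ y, ⟪U₀ y + U₁ y, (fderiv ℝ Φ y) (U₀ y + U₁ y)⟫
  refine GalileanFrames.eq_of_integral_deriv_mul_add_eq_zero_Iio (f := fun τ => A₀ + θ τ * A₁) (g := fun τ => deriv θ τ * A₁)
    (N := fun τ => N₀ + θ τ * (NS - N₀ - N₁) + θ τ ^ 2 * N₁)
    (fun τ _ => (((hθ1.differentiable (by norm_num)) τ).hasDerivAt.mul_const A₁).const_add A₀)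
    ((hθ'c.mul continuous_const).continuousOn)
    (((continuous_const.add (hθc.mul continuous_const)).add ((hθc.pow 2).mul continuous_const)).continuousOn) ?_ ht
  intro χ hχ hχc hχT
  exact raw_momentum hsol hT₁ hv hU₀ hU₁ hU₀2 hU₁2 hΦ hdiv hχ hχc hχT

/-- **POINTWISE DIVERGENCE BRACKET**: `∫⟪U₀,∇g⟫ + θ(t) ∫⟪U₁,∇g⟫ = 0` for every `t < T₁` (`θ` continuous). [folklore] -/
theorem pointwise_div
    (hsol : IsDistributionalNSSolutionOn (slab (EuclideanSpace ℝ (Fin 3)) (Iio 0) isOpen_Iio) 0 0 v p)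
    (hT₁ : T₁ ≤ 0) (hv : ∀ τ, τ < T₁ → v τ = fun x => U₀ x + θ τ • U₁ x) (hθc : Continuous θ)
    (hU₀ : LocallyIntegrable U₀ volume) (hU₁ : LocallyIntegrable U₁ volume)
    {g : EuclideanSpace ℝ (Fin 3) → ℝ} (hg : IsTestFunctionOn (⊤ : Opens (EuclideanSpace ℝ (Fin 3))) g) {t : ℝ} (ht : t < T₁) :
    (∫ y, ⟪U₀ y, gradient g y⟫) + θ t * ∫ y, ⟪U₁ y, gradient g y⟫ = 0 := by
  set D₀ : ℝ := ∫ y, ⟪U₀ y, gradient g y⟫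
  set D₁ : ℝ := ∫ y, ⟪U₁ y, gradient g y⟫
  have hG := GalileanFrames.isTestFunctionOn_gradient_field hg
  have hgc : Continuous (gradient g) := hG.contDiff.continuous
  have hgs : HasCompactSupport (gradient g) := hG.hasCompactSupport
  have iD0 := integrable_inner_of_locallyIntegrable_of_hasCompactSupport hU₀ hgc hgs
  have iD1 := integrable_inner_of_locallyIntegrable_of_hasCompactSupport hU₁ hgc hgs
  have h := GalileanFrames.eq_of_integral_deriv_mul_add_eq_zero_Iio (f := fun _ => (0 : ℝ)) (g := fun _ => (0 : ℝ))
    (N := fun τ => D₀ + θ τ * D₁) (fun τ _ => hasDerivAt_const τ (0 : ℝ)) continuousOn_const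
    ((continuous_const.add (hθc.mul continuous_const)).continuousOn) ?_ ht
  · simpa using h
  intro χ hχ hχc hχT
  have hχ0 : tsupport χ ⊆ Iio 0 := hχT.trans (Iio_subset_Iio hT₁)
  have h0 := GalileanFrames.integral_scalarTensorTest hsol hg hχ hχc hχ0
  have hχ0' : ∀ t, t ∉ tsupport χ → χ t = 0 := fun t ht => image_eq_zero_of_notMem_tsupport ht
  have hpt : ∀ τ, χ τ * (∫ y, ⟪v τ y, gradient g y⟫) = deriv χ τ * 0 + χ τ * (D₀ + θ τ * D₁) := by
    intro τ
    by_cases hτ : τ ∈ tsupport χ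
    · rw [hv τ (hχT hτ)]
      have e1 : ∫ y, ⟪U₀ y + θ τ • U₁ y, gradient g y⟫ = D₀ + θ τ * D₁ := by
        rw [← integral_const_mul, ← integral_add iD0 (iD1.const_mul _)]
        exact integral_congr_ae (Eventually.of_forall fun y => by simp only [inner_add_left, real_inner_smul_left])
      rw [e1]
      ring
    · rw [hχ0' τ hτ]
      ring
  simp_rw [hpt] at h0
  exact h0

/-! ## 3. The Riccati exception -/

/-- **ANNIHILATION OF THE PATTERN UNLESS A RICCATI EQUATION HOLDS.**  If `θ ∈ C¹` does NOT satisfy `θ' = α + βθ + γθ²` on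
`(−∞,T₁)` for any constants `α, β, γ`, then `∫⟪U₁, Φ⟫ = 0` for every divergence-free test field `Φ`. [folklore] -/
theorem integral_inner_eq_zero_of_not_riccati
    (hsol : IsDistributionalNSSolutionOn (slab (EuclideanSpace ℝ (Fin 3)) (Iio 0) isOpen_Iio) 0 0 v p)
    (hT₁ : T₁ ≤ 0) (hv : ∀ τ, τ < T₁ → v τ = fun x => U₀ x + θ τ • U₁ x) (hθ1 : ContDiff ℝ 1 θ)
    (hric : ¬ ∃ α β γ : ℝ, ∀ t, t < T₁ → deriv θ t = α + β * θ t + γ * θ t ^ 2)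
    (hU₀ : LocallyIntegrable U₀ volume) (hU₁ : LocallyIntegrable U₁ volume)
    (hU₀2 : LocallyIntegrable (fun y => ‖U₀ y‖ ^ 2) volume) (hU₁2 : LocallyIntegrable (fun y => ‖U₁ y‖ ^ 2) volume)
    {Φ : EuclideanSpace ℝ (Fin 3) → EuclideanSpace ℝ (Fin 3)} (hΦ : IsTestFunctionOn (⊤ : Opens (EuclideanSpace ℝ (Fin 3))) Φ)
    (hdiv : ∀ z, VectorCalculus.divergence Φ z = 0) :
    ∫ y, ⟪U₁ y, Φ y⟫ = 0 := by
  by_contra hA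
  apply hric
  set A₁ : ℝ := ∫ y, ⟪U₁ y, Φ y⟫
  set N₀ : ℝ := ∫ y, ⟪U₀ y, (fderiv ℝ Φ y) (U₀ y)⟫
  set N₁ : ℝ := ∫ y, ⟪U₁ y, (fderiv ℝ Φ y) (U₁ y)⟫
  set NS : ℝ := ∫ y, ⟪U₀ y + U₁ y, (fderiv ℝ Φ y) (U₀ y + U₁ y)⟫
  refine ⟨N₀ / A₁, (NS - N₀ - N₁) / A₁, N₁ / A₁, fun t ht => ?_⟩
  have h := pointwise_momentum hsol hT₁ hv hθ1 hU₀ hU₁ hU₀2 hU₁2 hΦ hdiv ht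
  field_simp
  linarith [h]

/-- **WEAK INCOMPRESSIBILITY OF THE PATTERN UNLESS A RICCATI EQUATION HOLDS** (the constant solutions `θ' = 0` are excluded, so `θ`
is not constant on the past and the divergence bracket splits). [folklore] -/
theorem isWeaklyDivFree_of_not_riccati
    (hsol : IsDistributionalNSSolutionOn (slab (EuclideanSpace ℝ (Fin 3)) (Iio 0) isOpen_Iio) 0 0 v p)
    (hT₁ : T₁ ≤ 0) (hv : ∀ τ, τ < T₁ → v τ = fun x => U₀ x + θ τ • U₁ x) (hθ1 : ContDiff ℝ 1 θ)
    (hric : ¬ ∃ α β γ : ℝ, ∀ t, t < T₁ → deriv θ t = α + β * θ t + γ * θ t ^ 2)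
    (hU₀ : LocallyIntegrable U₀ volume) (hU₁ : LocallyIntegrable U₁ volume) :
    IsWeaklyDivFree U₁ := by
  have hθc : Continuous θ := hθ1.continuous
  intro g hg
  set D₀ : ℝ := ∫ y, ⟪U₀ y, gradient g y⟫
  set D₁ : ℝ := ∫ y, ⟪U₁ y, gradient g y⟫
  by_contra hD
  apply hric
  -- `θ` is then constant on the past: `θ = −D₀/D₁`
  refine ⟨0, 0, 0, fun t ht => ?_⟩
  have hconst : ∀ s, s < T₁ → θ s = -D₀ / D₁ := by
    intro s hs
    have h := pointwise_div hsol hT₁ hv hθc hU₀ hU₁ hg hs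
    field_simp
    linarith [h]
  have hev : θ =ᶠ[𝓝 t] fun _ => -D₀ / D₁ := by
    filter_upwards [Iio_mem_nhds ht] with s hs
    exact hconst s hs
  rw [hev.deriv_eq, deriv_const]
  ring

end ModulatedEuler

end Summit.NavierStokesRegularity.NavierStokesRegularity.Theorems.PowerGaugeEulerLiouville

end
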